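import Summits.QuantumFields.BalabanUV.Beta.EriceRemainderEnclosureHistoryAutonomyComparisonTowerChainSix

/-!
# EriceRemainderEnclosureHistoryAutonomyComparisonTowerChainFourLemmas — (E66a) LEMMAS FOR THE DUAL CHAIN ON TOWERS OF RATIO `≥ 4`: the CUBIC STEP INEQUALITY of
# the hyperbolic invariant `λ = 4Z∕(2 − Z)` at the extreme transport `s = 1∕2` on the budget triangle `x, u ≥ 0`, `u ≤ (109∕120)(1∕2 − (200∕259)x)` (proved from
# an exact Handelman certificate — the `nlinarith` hints ARE the certificate's products — split at `x = 3∕10`), the chain condition there, the lattice constants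
# (diagonal window weight `S_{k,k}∕k ≥ 200∕259` for `k ≥ 5` by telescoping, exact sums `S_{4,4} ≥ 800∕259`, `S_{1,4} ≥ 240∕109` at `k = 4`), and **THE BUDGET
# LINE** `(200∕259)x_k + (120∕109)√(k⁻∕k)·Z_{k⁻} ≤ 1∕2` at every non-minimal age of a tower of ratio `≥ 4` under the window budget of (E65a) (`Z_{k⁻} =
# Σ_{s≤k⁻} x_s√(s∕k⁻)`; pressure conversion `(√(k⁻+k+1) + √(k⁻+1))∕(2√k) ≤ 109∕120` for `k ≥ 5`, `4k⁻ ≤ k`).  Consumed by (E66b) `dual_chain_of_tower_four`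

Cell `pub-balaban`, β-function sub-cell, BINDER row D4 «RemainderConst leaves for Bałaban's split» (`HOME/BINDER-OWNERS.md`; owner lineage `b2b-balaban-beta-an4`;
this file by co-owner #2 lineage `b2b-balaban-beta-d4-p2`, generation 59), β-FLOW TEAM duty (1), FREEZE (0) honoured (def-free; Mathlib + (E65a)'s
`mul_sqrt_le_readWindow` ∕ `readWindow_nonneg` and (E65i)'s `readWindow_ge_telescope` BY NAME).

HONEST FRAMING (page 1, verbatim and binding).  *"Discharging BetaPertH makes Bałaban's UV stability UNCONDITIONAL — a real constructive-QFT result; it is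
NOT the continuum limit and NOT the Clay problem."*  THIS FILE DISCHARGES NOTHING OF THE KIND.  Lemmas about finitely many non-negative reals; their use is
through (E65f), whose hypotheses are those of a census, not facts; nothing of Bałaban's is asserted.  Row D4 class UNCHANGED (critical-path width 0; instance
0∕1; D4 DISCHARGE NO DATE).  HONEST DEPENDENCY: continuum YM on T⁴ ⇐ BetaPertH ∧ nine spine estimates (0/9 proved); BetaPertH ⇐ (D1) ∧ (D4) ∧ CAP+tail;
G-an2-4 gates asym, D1 and NE2/3/4.

THE POINT (census sense (α); the COMPARISON column, conjecture (E58′), route (C″)).  See (E66b).  The numerics behind the constants (README `reach.py`,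
`inv4.py`, `poly4.py`, `handel.py`): the cubic's margin on the triangle is `≥ 0.058(x+u)`, thinnest on the budget line near `x = 0.30`; no degree-`≤ 4`
Handelman certificate exists on the whole triangle, one of degree `3` exists on each half.  NOT CLAIMED: anything printed.

WHAT IS PROVED ([folklore]; 0 `def`, 0 sorry).  §1 `step_poly4_low`, `step_poly4_high`, **`step_poly4`**, `cond_poly4`; `readWindow_one_four_ge`,
`readWindow_four_four_ge`, **`readWindow_diag_ge`**.  §2 `load_le_of_window_budget`, **`budget_line_of_tower_four`**.
-/
noncomputable section
open Finset

namespace Summit.QuantumFields.BalabanUV.Beta.EriceRemainderEnclosureHistoryAutonomyComparisonTowerChainFourLemmas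

open Summit.QuantumFields.BalabanUV.Beta.EriceRemainderEnclosureHistoryAutonomyComparisonLoadBudgetWindow (mul_sqrt_le_readWindow readWindow_nonneg)
open Summit.QuantumFields.BalabanUV.Beta.EriceRemainderEnclosureHistoryAutonomyComparisonTowerChainSix (readWindow_ge_telescope)

/-! ## §1 The cubic step inequality (exact Handelman certificates), the condition, and the lattice constants -/

/-- The λ-recursion of the dual chain on a tower of ratio `≥ 4` for the hyperbolic invariant `λ = 4Z∕(2 − Z)`, at the extreme transport `s = 1∕2`, denominators
cleared: `[u(1 + x∕4) + x(1 + u)](2 − x − u) ≤ 4(x + u)[(1 − u)(1 − 3x∕4) − 2ux]` on the budget triangle `x, u ≥ 0`, `u ≤ (109∕120)(1∕2 − (200∕259)x)` — the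
part `x ≤ 3∕10` (the `nlinarith` hints are the eight products of an exact Handelman certificate). [folklore] -/
theorem step_poly4_low {x u : ℝ} (hx : 0 ≤ x) (hx1 : x ≤ 3 / 10) (hu : 0 ≤ u) (hu1 : u ≤ 109 / 120 * (1 / 2 - 200 / 259 * x)) :
    (u * (1 + x / 4) + x * (1 + u)) * (2 - x - u) ≤ 4 * (x + u) * ((1 - u) * (1 - 3 / 4 * x) - 2 * u * x) := by
  have h1 : 0 ≤ 3 / 10 - x := sub_nonneg.mpr hx1
  have hb : 0 ≤ 109 / 120 * (1 / 2 - 200 / 259 * x) - u := sub_nonneg.mpr hu1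
  nlinarith [mul_nonneg hu hb, mul_nonneg (mul_nonneg h1 hu) hu, mul_nonneg (mul_nonneg h1 h1) hu, mul_nonneg hx hb,
    mul_nonneg (mul_nonneg hx hu) hb, mul_nonneg (mul_nonneg hx h1) h1, mul_nonneg hx hx, mul_nonneg (mul_nonneg hx hx) hb]

/-- … and the part `3∕10 ≤ x ≤ 259∕400`. [folklore] -/
theorem step_poly4_high {x u : ℝ} (hx : 3 / 10 ≤ x) (hx1 : x ≤ 259 / 400) (hu : 0 ≤ u) (hu1 : u ≤ 109 / 120 * (1 / 2 - 200 / 259 * x)) :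
    (u * (1 + x / 4) + x * (1 + u)) * (2 - x - u) ≤ 4 * (x + u) * ((1 - u) * (1 - 3 / 4 * x) - 2 * u * x) := by
  have h0 : 0 ≤ x - 3 / 10 := sub_nonneg.mpr hx
  have h1 : 0 ≤ 259 / 400 - x := sub_nonneg.mpr hx1
  have hb : 0 ≤ 109 / 120 * (1 / 2 - 200 / 259 * x) - u := sub_nonneg.mpr hu1
  nlinarith [hb, mul_nonneg hu hb, mul_nonneg hu hu, mul_nonneg h0 hb, mul_nonneg (mul_nonneg h0 hu) hb,
    mul_nonneg (mul_nonneg h0 hu) hu, mul_nonneg h0 h0, h1]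

/-- **THE CUBIC STEP INEQUALITY** on the whole budget triangle `x, u ≥ 0`, `u ≤ (109∕120)(1∕2 − (200∕259)x)` (margin `≥ 0.058(x+u)`). [folklore] -/
theorem step_poly4 {x u : ℝ} (hx : 0 ≤ x) (hu : 0 ≤ u) (hu1 : u ≤ 109 / 120 * (1 / 2 - 200 / 259 * x)) :
    (u * (1 + x / 4) + x * (1 + u)) * (2 - x - u) ≤ 4 * (x + u) * ((1 - u) * (1 - 3 / 4 * x) - 2 * u * x) := by
  have hx1 : x ≤ 259 / 400 := by nlinarith
  rcases le_or_gt x (3 / 10) with h | h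
  · exact step_poly4_low hx h hu hu1
  · exact step_poly4_high h.le hx1 hu hu1

/-- The chain condition on the budget triangle, denominator `1 − u` cleared: `x(2u + (3∕4)(1 − u)) < 1 − u` (i.e. `x(2u∕(1−u) + 3∕4) < 1`; value `≤ 0.50`). [folklore] -/
theorem cond_poly4 {x u : ℝ} (hx : 0 ≤ x) (hu : 0 ≤ u) (hu1 : u ≤ 109 / 120 * (1 / 2 - 200 / 259 * x)) :
    x * (2 * u + 3 / 4 * (1 - u)) < 1 - u := by
  nlinarith [mul_nonneg hx hu, mul_nonneg hx (sub_nonneg.mpr hu1)]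

/-- The exact young read at `k = 4`, `k⁻ = 1`: `S_{1,4} = √(1∕2) + √(1∕3) + √(1∕4) + √(1∕5) ≥ 240∕109` (`= 2.2317…`; the telescoped bound gives only `2.07`). [folklore] -/
theorem readWindow_one_four_ge : (240 : ℝ) / 109 ≤ ∑ l ∈ range 4, Real.sqrt ((1 : ℝ) / ((1 : ℝ) + l + 1)) := by
  simp only [sum_range_succ, sum_range_zero, Nat.cast_zero, Nat.cast_one, Nat.cast_ofNat]
  have h2 : (7 : ℝ) / 10 ≤ Real.sqrt (1 / (1 + 0 + 1)) := by
    rw [show (7 : ℝ) / 10 = Real.sqrt ((7 / 10) ^ 2) by rw [Real.sqrt_sq (by norm_num)]]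
    exact Real.sqrt_le_sqrt (by norm_num)
  have h3 : (577 : ℝ) / 1000 ≤ Real.sqrt (1 / (1 + 1 + 1)) := by
    rw [show (577 : ℝ) / 1000 = Real.sqrt ((577 / 1000) ^ 2) by rw [Real.sqrt_sq (by norm_num)]]
    exact Real.sqrt_le_sqrt (by norm_num)
  have h4 : (1 : ℝ) / 2 ≤ Real.sqrt (1 / (1 + 2 + 1)) := by
    rw [show (1 : ℝ) / 2 = Real.sqrt ((1 / 2) ^ 2) by rw [Real.sqrt_sq (by norm_num)]]
    exact Real.sqrt_le_sqrt (by norm_num)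
  have h5 : (447 : ℝ) / 1000 ≤ Real.sqrt (1 / (1 + 3 + 1)) := by
    rw [show (447 : ℝ) / 1000 = Real.sqrt ((447 / 1000) ^ 2) by rw [Real.sqrt_sq (by norm_num)]]
    exact Real.sqrt_le_sqrt (by norm_num)
  linarith

/-- The exact diagonal read at `k = 4`: `S_{4,4} = √(4∕5) + √(4∕6) + √(4∕7) + √(4∕8) ≥ 800∕259` (`= 3.174…`; telescoped: `3.06`). [folklore] -/
theorem readWindow_four_four_ge : (800 : ℝ) / 259 ≤ ∑ l ∈ range 4, Real.sqrt ((4 : ℝ) / ((4 : ℝ) + l + 1)) := by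
  simp only [sum_range_succ, sum_range_zero, Nat.cast_zero, Nat.cast_one, Nat.cast_ofNat]
  have h2 : (89 : ℝ) / 100 ≤ Real.sqrt (4 / (4 + 0 + 1)) := by
    rw [show (89 : ℝ) / 100 = Real.sqrt ((89 / 100) ^ 2) by rw [Real.sqrt_sq (by norm_num)]]
    exact Real.sqrt_le_sqrt (by norm_num)
  have h3 : (81 : ℝ) / 100 ≤ Real.sqrt (4 / (4 + 1 + 1)) := by
    rw [show (81 : ℝ) / 100 = Real.sqrt ((81 / 100) ^ 2) by rw [Real.sqrt_sq (by norm_num)]]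
    exact Real.sqrt_le_sqrt (by norm_num)
  have h4 : (3 : ℝ) / 4 ≤ Real.sqrt (4 / (4 + 2 + 1)) := by
    rw [show (3 : ℝ) / 4 = Real.sqrt ((3 / 4) ^ 2) by rw [Real.sqrt_sq (by norm_num)]]
    exact Real.sqrt_le_sqrt (by norm_num)
  have h5 : (7 : ℝ) / 10 ≤ Real.sqrt (4 / (4 + 3 + 1)) := by
    rw [show (7 : ℝ) / 10 = Real.sqrt ((7 / 10) ^ 2) by rw [Real.sqrt_sq (by norm_num)]]
    exact Real.sqrt_le_sqrt (by norm_num)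
  linarith

/-- **THE DIAGONAL WINDOW WEIGHT FOR `k ≥ 5`**: `S_{k,k} ≥ (200∕259)·k` — (E65i)'s telescoped `S_{k,k} ≥ 2√k(√(2k+1) − √(k+1)) = 2k√k∕(√(2k+1) + √(k+1))` with
`√(2k+1) ≤ (149∕100)√k`, `√(k+1) ≤ (11∕10)√k` (`k ≥ 5`); limit `2(√2 − 1) = 0.828`. [folklore] -/
theorem readWindow_diag_ge {k : ℕ} (hk : 5 ≤ k) :
    (200 : ℝ) / 259 * k ≤ ∑ l ∈ range k, Real.sqrt ((k : ℝ) / ((k : ℝ) + l + 1)) := by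
  have hkr : (5 : ℝ) ≤ k := by exact_mod_cast hk
  have hk0 : (0 : ℝ) < k := by linarith
  have htel := readWindow_ge_telescope hk0 k
  have hsk : 0 < Real.sqrt (k : ℝ) := Real.sqrt_pos.mpr hk0
  have hA : Real.sqrt ((k : ℝ) + k + 1) ≤ 149 / 100 * Real.sqrt (k : ℝ) := by
    rw [show (149 : ℝ) / 100 * Real.sqrt (k : ℝ) = Real.sqrt ((149 / 100) ^ 2 * k) by
      rw [Real.sqrt_mul (by norm_num), Real.sqrt_sq (by norm_num)]]
    exact Real.sqrt_le_sqrt (by nlinarith)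
  have hB : Real.sqrt ((k : ℝ) + 1) ≤ 11 / 10 * Real.sqrt (k : ℝ) := by
    rw [show (11 : ℝ) / 10 * Real.sqrt (k : ℝ) = Real.sqrt ((11 / 10) ^ 2 * k) by
      rw [Real.sqrt_mul (by norm_num), Real.sqrt_sq (by norm_num)]]
    exact Real.sqrt_le_sqrt (by nlinarith)
  have hden : 0 < Real.sqrt ((k : ℝ) + k + 1) + Real.sqrt ((k : ℝ) + 1) := by positivity
  have hdiff : Real.sqrt ((k : ℝ) + k + 1) - Real.sqrt ((k : ℝ) + 1) = k / (Real.sqrt ((k : ℝ) + k + 1) + Real.sqrt ((k : ℝ) + 1)) := by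
    have e1 : Real.sqrt ((k : ℝ) + k + 1) * Real.sqrt ((k : ℝ) + k + 1) = (k : ℝ) + k + 1 := Real.mul_self_sqrt (by positivity)
    have e2 : Real.sqrt ((k : ℝ) + 1) * Real.sqrt ((k : ℝ) + 1) = (k : ℝ) + 1 := Real.mul_self_sqrt (by positivity)
    have hab : (Real.sqrt ((k : ℝ) + k + 1) - Real.sqrt ((k : ℝ) + 1)) * (Real.sqrt ((k : ℝ) + k + 1) + Real.sqrt ((k : ℝ) + 1)) = k := by
      nlinarith [e1, e2]
    rw [eq_div_iff hden.ne']; exact hab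
  have hlow : (200 : ℝ) / 259 * k ≤ 2 * Real.sqrt (k : ℝ) * (Real.sqrt ((k : ℝ) + k + 1) - Real.sqrt ((k : ℝ) + 1)) := by
    rw [hdiff]
    have hsum : Real.sqrt ((k : ℝ) + k + 1) + Real.sqrt ((k : ℝ) + 1) ≤ 259 / 100 * Real.sqrt (k : ℝ) := by linarith
    rw [mul_div_assoc', le_div_iff₀ hden]
    calc (200 : ℝ) / 259 * k * (Real.sqrt ((k : ℝ) + k + 1) + Real.sqrt ((k : ℝ) + 1))
        ≤ (200 : ℝ) / 259 * k * (259 / 100 * Real.sqrt (k : ℝ)) := mul_le_mul_of_nonneg_left hsum (by positivity)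
      _ = 2 * Real.sqrt (k : ℝ) * k := by ring
  exact hlow.trans htel

/-! ## §2 The load cap and the budget line on a tower of ratio `≥ 4` -/

/-- **THE LOAD CAP**: under the window budget at the scale `k ∈ A` (ages `≥ 1`, loads `≥ 0`), `x_k ≤ 71∕100` (`x_k·S_{k,k}∕k ≤ 1∕2`, `S_{k,k}∕k ≥ √(1∕2) ≥ 50∕71`).
[folklore] -/
theorem load_le_of_window_budget {A : Finset ℕ} {x : ℕ → ℝ} {k : ℕ} (hA1 : ∀ k ∈ A, 1 ≤ k) (hx : ∀ k ∈ A, 0 ≤ x k) (hk : k ∈ A)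
    (hbud : ∑ s ∈ A, x s * (if s ≤ k then (∑ l ∈ range k, Real.sqrt ((s : ℝ) / ((s : ℝ) + l + 1))) / k
        else (∑ l ∈ range k, Real.sqrt ((s : ℝ) / ((s : ℝ) + l + 1))) / s) ≤ 1 / 2) :
    x k * ((∑ l ∈ range k, Real.sqrt ((k : ℝ) / ((k : ℝ) + l + 1))) / k) ≤ 1 / 2 ∧ x k ≤ 71 / 100 := by
  have hhalf' : (50 : ℝ) / 71 ≤ Real.sqrt (1 / 2) := by
    rw [show (50 : ℝ) / 71 = Real.sqrt ((50 / 71) ^ 2) by rw [Real.sqrt_sq (by norm_num)]]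
    exact Real.sqrt_le_sqrt (by norm_num)
  have hkr : (0 : ℝ) < k := by exact_mod_cast hA1 k hk
  have hdiag : Real.sqrt ((k : ℝ) / ((k : ℝ) + k)) = Real.sqrt (1 / 2) := by
    congr 1; field_simp; ring
  have hW0 : ∀ s : ℕ, 0 ≤ (if s ≤ k then (∑ l ∈ range k, Real.sqrt ((s : ℝ) / ((s : ℝ) + l + 1))) / k
      else (∑ l ∈ range k, Real.sqrt ((s : ℝ) / ((s : ℝ) + l + 1))) / s) := fun s => by
    have := readWindow_nonneg s k; split_ifs <;> positivity
  have hown : x k * Real.sqrt (1 / 2) ≤ x k * ((∑ l ∈ range k, Real.sqrt ((k : ℝ) / ((k : ℝ) + l + 1))) / k) := by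
    refine mul_le_mul_of_nonneg_left ?_ (hx k hk)
    rw [← hdiag, le_div_iff₀ hkr, mul_comm]
    exact mul_sqrt_le_readWindow k k
  have hsing := single_le_sum (f := fun s => x s * (if s ≤ k then (∑ l ∈ range k, Real.sqrt ((s : ℝ) / ((s : ℝ) + l + 1))) / k
      else (∑ l ∈ range k, Real.sqrt ((s : ℝ) / ((s : ℝ) + l + 1))) / s)) (fun s hs => mul_nonneg (hx s hs) (hW0 s)) hk
  have h0 : x k * ((∑ l ∈ range k, Real.sqrt ((k : ℝ) / ((k : ℝ) + l + 1))) / k) ≤ 1 / 2 := by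
    have := hsing.trans hbud; simpa only [le_refl, if_true] using this
  refine ⟨h0, ?_⟩
  have h2 : x k * (50 / 71) ≤ x k * Real.sqrt (1 / 2) := mul_le_mul_of_nonneg_left hhalf' (hx k hk)
  linarith [hown.trans h0]

set_option maxHeartbeats 400000 in
/-- **THE BUDGET LINE ON A TOWER OF RATIO `≥ 4`.**  `A` a finite set of ages `≥ 1` with minimum `m₀` and predecessor map `pred`, `4·pred k ≤ k`; loads `x ≥ 0`
obeying the window budget of (E65a) at the scales `j = k ∈ A`.  Then at every `k ≠ m₀`: **`(200∕259)x_k + (120∕109)√(pred k∕k)·Z_{pred k} ≤ 1∕2`**, `Z_q =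
Σ_{s∈A, s≤q} x_s√(s∕q)`.  Keep the ages `≤ k` in the budget; the diagonal read is `S_{k,k}∕k ≥ 200∕259` (`readWindow_diag_ge` for `k ≥ 5`, the exact sum at
`k = 4`); the young reads are `S_{s,k}∕k ≥ 2√s∕(√(pred k+k+1) + √(pred k+1))` ((E65i) telescoping) and `(√(pred k+k+1) + √(pred k+1))∕(2√k) ≤ 109∕120` as soon
as `5(pred k + 1) ≤ 2k` (automatic for `k ≥ 5`, `4·pred k ≤ k`); at `k = 4` (`pred k = m₀ = 1`) the exact `S_{1,4} ≥ 240∕109`. [folklore] -/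
theorem budget_line_of_tower_four {A : Finset ℕ} {x : ℕ → ℝ} {pred : ℕ → ℕ} {m₀ : ℕ}
    (hA1 : ∀ k ∈ A, 1 ≤ k) (hx : ∀ k ∈ A, 0 ≤ x k) (hm₀ : m₀ ∈ A) (hmin : ∀ k ∈ A, m₀ ≤ k)
    (hpred : ∀ k ∈ A, k ≠ m₀ → pred k ∈ A ∧ pred k < k ∧ ∀ k'' ∈ A, k'' < k → k'' ≤ pred k)
    (hfour : ∀ k ∈ A, k ≠ m₀ → 4 * pred k ≤ k)
    (hbud : ∀ k ∈ A, ∑ s ∈ A, x s * (if s ≤ k then (∑ l ∈ range k, Real.sqrt ((s : ℝ) / ((s : ℝ) + l + 1))) / k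
        else (∑ l ∈ range k, Real.sqrt ((s : ℝ) / ((s : ℝ) + l + 1))) / s) ≤ 1 / 2)
    {k : ℕ} (hk : k ∈ A) (hne : k ≠ m₀) :
    x k * (200 / 259) + Real.sqrt ((pred k : ℝ) / k) *
        (∑ s ∈ A.filter (fun s => s ≤ pred k), x s * Real.sqrt ((s : ℝ) / pred k)) * (120 / 109) ≤ 1 / 2 := by
  have hW0 : ∀ k s : ℕ, 0 ≤ (if s ≤ k then (∑ l ∈ range k, Real.sqrt ((s : ℝ) / ((s : ℝ) + l + 1))) / k
      else (∑ l ∈ range k, Real.sqrt ((s : ℝ) / ((s : ℝ) + l + 1))) / s) := fun k s => by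
    have := readWindow_nonneg s k; split_ifs <;> positivity
  obtain ⟨hpA, hplt, hpmax⟩ := hpred k hk hne
  have hkr : (0 : ℝ) < k := by exact_mod_cast hA1 k hk
  have hpr : (0 : ℝ) < pred k := by exact_mod_cast hA1 _ hpA
  have hp1 : 1 ≤ pred k := hA1 _ hpA
  have hfour' : 4 * pred k ≤ k := hfour k hk hne
  have hxk := hx k hk
  have hZ0 : 0 ≤ ∑ s ∈ A.filter (fun s => s ≤ pred k), x s * Real.sqrt ((s : ℝ) / pred k) :=
    sum_nonneg fun s hs => mul_nonneg (hx s (mem_filter.mp hs).1) (Real.sqrt_nonneg _)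
  -- the budget at scale k with the ages ≤ k kept: diagonal + young reads
  have hset_le : A.filter (fun s => s ≤ k) = insert k (A.filter (fun s => s ≤ pred k)) := by
    ext s; simp only [mem_filter, mem_insert]
    constructor
    · rintro ⟨hs, hsk⟩
      rcases lt_or_eq_of_le hsk with h | h
      · exact Or.inr ⟨hs, hpmax s hs h⟩
      · exact Or.inl h
    · rintro (rfl | ⟨hs, hsp⟩)
      · exact ⟨hk, le_rfl⟩
      · exact ⟨hs, hsp.trans hplt.le⟩
  have hnot : k ∉ A.filter (fun s => s ≤ pred k) := by
    simp only [mem_filter, not_and, not_le]; exact fun _ => hplt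
  have hd : x k * ((∑ l ∈ range k, Real.sqrt ((k : ℝ) / ((k : ℝ) + l + 1))) / k) +
      ∑ s ∈ A.filter (fun s => s ≤ pred k), x s * ((∑ l ∈ range k, Real.sqrt ((s : ℝ) / ((s : ℝ) + l + 1))) / k) ≤ 1 / 2 := by
    have hb := hbud k hk
    have hdrop' : ∑ s ∈ A.filter (fun s => s ≤ k), x s * ((∑ l ∈ range k, Real.sqrt ((s : ℝ) / ((s : ℝ) + l + 1))) / k) ≤
        ∑ s ∈ A, x s * (if s ≤ k then (∑ l ∈ range k, Real.sqrt ((s : ℝ) / ((s : ℝ) + l + 1))) / k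
          else (∑ l ∈ range k, Real.sqrt ((s : ℝ) / ((s : ℝ) + l + 1))) / s) := by
      calc ∑ s ∈ A.filter (fun s => s ≤ k), x s * ((∑ l ∈ range k, Real.sqrt ((s : ℝ) / ((s : ℝ) + l + 1))) / k)
          = ∑ s ∈ A.filter (fun s => s ≤ k), x s * (if s ≤ k then (∑ l ∈ range k, Real.sqrt ((s : ℝ) / ((s : ℝ) + l + 1))) / k
              else (∑ l ∈ range k, Real.sqrt ((s : ℝ) / ((s : ℝ) + l + 1))) / s) :=
            sum_congr rfl fun s hs => by rw [if_pos (mem_filter.mp hs).2]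
        _ ≤ _ := sum_le_sum_of_subset_of_nonneg (filter_subset _ A) fun s hs _ => mul_nonneg (hx s hs) (hW0 k s)
    rw [hset_le, sum_insert hnot] at hdrop'
    exact hdrop'.trans hb
  by_cases hk5 : 5 ≤ k
  · -- diagonal: telescoped; young: telescoped with the conversion constant 109/120
    have hdg : x k * (200 / 259) ≤ x k * ((∑ l ∈ range k, Real.sqrt ((k : ℝ) / ((k : ℝ) + l + 1))) / k) := by
      refine mul_le_mul_of_nonneg_left ?_ hxk
      rw [le_div_iff₀ hkr]; exact readWindow_diag_ge hk5
    have h52 : 5 * (pred k + 1) ≤ 2 * k := by omega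
    have h52r : 5 * ((pred k : ℝ) + 1) ≤ 2 * k := by exact_mod_cast h52
    obtain ⟨ρ, hρ_def⟩ : ∃ ρ : ℝ, ρ = 2 * Real.sqrt (pred k : ℝ) / (Real.sqrt ((pred k : ℝ) + k + 1) + Real.sqrt ((pred k : ℝ) + 1)) := ⟨_, rfl⟩
    have hden : 0 < Real.sqrt ((pred k : ℝ) + k + 1) + Real.sqrt ((pred k : ℝ) + 1) := by positivity
    have hρ0 : 0 ≤ ρ := by rw [hρ_def]; positivity
    have hyoung : ρ * ∑ s ∈ A.filter (fun s => s ≤ pred k), x s * Real.sqrt ((s : ℝ) / pred k) ≤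
        ∑ s ∈ A.filter (fun s => s ≤ pred k), x s * ((∑ l ∈ range k, Real.sqrt ((s : ℝ) / ((s : ℝ) + l + 1))) / k) := by
      rw [mul_sum]
      refine sum_le_sum fun s hs => ?_
      have hsA := (mem_filter.mp hs).1; have hsp : s ≤ pred k := (mem_filter.mp hs).2
      have hs1 : (0 : ℝ) < s := by exact_mod_cast hA1 s hsA
      have hsp' : (s : ℝ) ≤ pred k := by exact_mod_cast hsp
      have htel := readWindow_ge_telescope hs1 k
      have hposs : 0 < Real.sqrt ((s : ℝ) + k + 1) + Real.sqrt ((s : ℝ) + 1) := by positivity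
      have hdiff : Real.sqrt ((s : ℝ) + k + 1) - Real.sqrt ((s : ℝ) + 1) = k / (Real.sqrt ((s : ℝ) + k + 1) + Real.sqrt ((s : ℝ) + 1)) := by
        have e1 : Real.sqrt ((s : ℝ) + k + 1) * Real.sqrt ((s : ℝ) + k + 1) = (s : ℝ) + k + 1 := Real.mul_self_sqrt (by positivity)
        have e2 : Real.sqrt ((s : ℝ) + 1) * Real.sqrt ((s : ℝ) + 1) = (s : ℝ) + 1 := Real.mul_self_sqrt (by positivity)
        have hab : (Real.sqrt ((s : ℝ) + k + 1) - Real.sqrt ((s : ℝ) + 1)) * (Real.sqrt ((s : ℝ) + k + 1) + Real.sqrt ((s : ℝ) + 1)) = k := by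
          nlinarith [e1, e2]
        rw [eq_div_iff hposs.ne']; exact hab
      have hdens : Real.sqrt ((s : ℝ) + k + 1) + Real.sqrt ((s : ℝ) + 1) ≤ Real.sqrt ((pred k : ℝ) + k + 1) + Real.sqrt ((pred k : ℝ) + 1) :=
        add_le_add (Real.sqrt_le_sqrt (by linarith)) (Real.sqrt_le_sqrt (by linarith))
      have hW : 2 * Real.sqrt (s : ℝ) / (Real.sqrt ((pred k : ℝ) + k + 1) + Real.sqrt ((pred k : ℝ) + 1)) ≤
          (∑ l ∈ range k, Real.sqrt ((s : ℝ) / ((s : ℝ) + l + 1))) / k := by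
        rw [le_div_iff₀ hkr]
        calc 2 * Real.sqrt (s : ℝ) / (Real.sqrt ((pred k : ℝ) + k + 1) + Real.sqrt ((pred k : ℝ) + 1)) * k
            ≤ 2 * Real.sqrt (s : ℝ) / (Real.sqrt ((s : ℝ) + k + 1) + Real.sqrt ((s : ℝ) + 1)) * k := by
              apply mul_le_mul_of_nonneg_right _ hkr.le
              exact div_le_div_of_nonneg_left (by positivity) hposs hdens
          _ = 2 * Real.sqrt (s : ℝ) * (Real.sqrt ((s : ℝ) + k + 1) - Real.sqrt ((s : ℝ) + 1)) := by rw [hdiff]; field_simp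
          _ ≤ ∑ l ∈ range k, Real.sqrt ((s : ℝ) / ((s : ℝ) + l + 1)) := htel
      have hsq : Real.sqrt (s : ℝ) = Real.sqrt (pred k : ℝ) * Real.sqrt ((s : ℝ) / pred k) := by
        rw [← Real.sqrt_mul (by positivity)]; congr 1; field_simp
      calc ρ * (x s * Real.sqrt ((s : ℝ) / pred k)) = x s * (2 * Real.sqrt (s : ℝ) / (Real.sqrt ((pred k : ℝ) + k + 1) + Real.sqrt ((pred k : ℝ) + 1))) := by
            rw [hρ_def, hsq]; ring
        _ ≤ x s * ((∑ l ∈ range k, Real.sqrt ((s : ℝ) / ((s : ℝ) + l + 1))) / k) := mul_le_mul_of_nonneg_left hW (hx s hsA)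
    have hsqrtk : 0 < Real.sqrt (k : ℝ) := Real.sqrt_pos.mpr hkr
    have hA' : Real.sqrt ((pred k : ℝ) + k + 1) ≤ 71 / 60 * Real.sqrt (k : ℝ) := by
      rw [show (71 : ℝ) / 60 * Real.sqrt (k : ℝ) = Real.sqrt ((71 / 60) ^ 2 * k) by
        rw [Real.sqrt_mul (by norm_num), Real.sqrt_sq (by norm_num)]]
      exact Real.sqrt_le_sqrt (by nlinarith)
    have hB' : Real.sqrt ((pred k : ℝ) + 1) ≤ 19 / 30 * Real.sqrt (k : ℝ) := by
      rw [show (19 : ℝ) / 30 * Real.sqrt (k : ℝ) = Real.sqrt ((19 / 30) ^ 2 * k) by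
        rw [Real.sqrt_mul (by norm_num), Real.sqrt_sq (by norm_num)]]
      exact Real.sqrt_le_sqrt (by nlinarith)
    have hconv : Real.sqrt ((pred k : ℝ) / k) = (Real.sqrt ((pred k : ℝ) + k + 1) + Real.sqrt ((pred k : ℝ) + 1)) / (2 * Real.sqrt (k : ℝ)) * ρ := by
      rw [hρ_def, Real.sqrt_div (by positivity)]
      field_simp
    have hfac : (Real.sqrt ((pred k : ℝ) + k + 1) + Real.sqrt ((pred k : ℝ) + 1)) / (2 * Real.sqrt (k : ℝ)) ≤ 109 / 120 := by
      rw [div_le_iff₀ (by positivity)]; linarith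
    have hρZ0 : 0 ≤ ρ * ∑ s ∈ A.filter (fun s => s ≤ pred k), x s * Real.sqrt ((s : ℝ) / pred k) := mul_nonneg hρ0 hZ0
    have hyg : Real.sqrt ((pred k : ℝ) / k) * (∑ s ∈ A.filter (fun s => s ≤ pred k), x s * Real.sqrt ((s : ℝ) / pred k)) * (120 / 109) ≤
        ρ * ∑ s ∈ A.filter (fun s => s ≤ pred k), x s * Real.sqrt ((s : ℝ) / pred k) := by
      calc Real.sqrt ((pred k : ℝ) / k) * (∑ s ∈ A.filter (fun s => s ≤ pred k), x s * Real.sqrt ((s : ℝ) / pred k)) * (120 / 109)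
          = (Real.sqrt ((pred k : ℝ) + k + 1) + Real.sqrt ((pred k : ℝ) + 1)) / (2 * Real.sqrt (k : ℝ)) *
              (ρ * ∑ s ∈ A.filter (fun s => s ≤ pred k), x s * Real.sqrt ((s : ℝ) / pred k)) * (120 / 109) := by
            rw [hconv]; ring
        _ ≤ 109 / 120 * (ρ * ∑ s ∈ A.filter (fun s => s ≤ pred k), x s * Real.sqrt ((s : ℝ) / pred k)) * (120 / 109) :=
            mul_le_mul_of_nonneg_right (mul_le_mul_of_nonneg_right hfac hρZ0) (by norm_num)
        _ = ρ * ∑ s ∈ A.filter (fun s => s ≤ pred k), x s * Real.sqrt ((s : ℝ) / pred k) := by ring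
    linarith
  · -- k = 4, pred k = 1 = m₀: exact sums
    have hk4 : k = 4 := by omega
    have hp1' : pred k = 1 := by omega
    have hm1 : m₀ = 1 := le_antisymm (hp1' ▸ hmin _ hpA) (hA1 m₀ hm₀)
    have hfilter_m₀ : A.filter (fun s => s ≤ m₀) = {m₀} := by
      ext s; simp only [mem_filter, mem_singleton]
      constructor
      · rintro ⟨hs, hsm⟩; exact le_antisymm hsm (hmin s hs)
      · rintro rfl; exact ⟨hm₀, le_rfl⟩
    have hfilt : A.filter (fun s => s ≤ pred k) = {m₀} := by rw [hp1', ← hm1]; exact hfilter_m₀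
    rw [hfilt, sum_singleton] at hd
    rw [hfilt, sum_singleton]
    have hm1r : (0 : ℝ) < m₀ := by exact_mod_cast hA1 m₀ hm₀
    have hZ1 : x m₀ * Real.sqrt ((m₀ : ℝ) / pred k) = x m₀ := by
      rw [hp1', ← hm1, div_self hm1r.ne', Real.sqrt_one, mul_one]
    have hsq14 : Real.sqrt ((pred k : ℝ) / k) = 1 / 2 := by
      rw [hp1', hk4]; push_cast
      rw [show (1 : ℝ) / 4 = (1 / 2) ^ 2 by norm_num]; exact Real.sqrt_sq (by norm_num)
    rw [hZ1, hsq14]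
    rw [hk4, hm1] at hd; push_cast at hd
    have hS44 := readWindow_four_four_ge
    have hS14 := readWindow_one_four_ge
    have hx4 : 0 ≤ x 4 := hk4 ▸ hxk
    have hx1 : 0 ≤ x 1 := hm1 ▸ hx m₀ hm₀
    rw [hm1]
    have e1 : x 4 * (200 / 259) ≤ x 4 * ((∑ l ∈ range 4, Real.sqrt ((4 : ℝ) / ((4 : ℝ) + l + 1))) / 4) := by
      refine mul_le_mul_of_nonneg_left ?_ hx4
      rw [le_div_iff₀ (by norm_num : (0 : ℝ) < 4)]; linarith
    have e2 : 1 / 2 * x 1 * (120 / 109) ≤ x 1 * ((∑ l ∈ range 4, Real.sqrt ((1 : ℝ) / ((1 : ℝ) + l + 1))) / 4) := by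
      rw [show 1 / 2 * x 1 * (120 / 109) = x 1 * (60 / 109 : ℝ) by ring]
      refine mul_le_mul_of_nonneg_left ?_ hx1
      rw [le_div_iff₀ (by norm_num : (0 : ℝ) < 4)]; linarith
    have hk4x : x k = x 4 := by rw [hk4]
    rw [hk4x]
    linarith

end Summit.QuantumFields.BalabanUV.Beta.EriceRemainderEnclosureHistoryAutonomyComparisonTowerChainFourLemmas

end
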